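import Literature.AlgebraicGeometry.Frobenioids.AngularFrobenioidsRelative
import Literature.AlgebraicGeometry.Frobenioids.ArchimedeanBaseComparison
import Literature.AlgebraicGeometry.Frobenioids.ArchimedeanMonoCounterexample
import HarnessLib

/-!
# Frobenioids II, Proposition 3.4 (FSM-Morphisms) and Remark 3.4.1

Mochizuki, *The geometry of Frobenioids II: poly-Frobenioids*, Kyushu J. Math. **62** (2008)
401–460, §3, Proposition 3.4 (i)–(viii) pp. 29–30 (proof pp. 30–33) and Remark 3.4.1 p. 33
[cite: MochizukiFrdII2008, Prop 3.4 pp.29-33].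

"In the notation and terminology of Example 3.3, let `F` be one of the following categories: `A`,
`N`, `R`. If `F = A` (respectively, `F = N`; `F = R`), then set `F₀ = A₀` (respectively, `F₀ = N₀`;
`F₀ = R₀`)." Each item speaks about the TOWER `F → D`, `F → F₀ → D₀`; we record that tower once as the
structure `ArchFrd.Tower π` (with the pre-Frobenioid structures used for the Frobenioid-theoretic words
about `F` and `F₀` — `A`'s own structure over the zero monoid, and for `N`, `R` the structures induced
from `C`, `C₀`, cf. Ex. 3.3 (iv) "such terminology is to be interpreted as referring to the images …
in `C`"), state every item ONCE as a predicate `Prop34_…_of (T : Tower π)`, and define the printed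
item as the conjunction over the three towers `towerA`, `towerN`, `towerR`. "Complexifiable",
"RC-connected" are abc-iut-L1-t4's `RC.*` (Def. 3.1 (v)) through the comparison functor
`ArchFrd.D0.toArchBase`; "lifts" in (vi) is rendered up to an isomorphism of the middle object of `D`.
All items of Prop. 3.4 are named statements (typed, not discharged; proof pp. 30–33 is deep-pool
material); Remark 3.4.1 is PROVED (`Rmk341_holds`, example of `ArchimedeanMonoCounterexample.lean`).

STANDING-HYPOTHESES DISCLOSURE (referee finding J9-F1, ruling R49 (3); docstring-only revision, all
declaration bytes unchanged). The eight printed items `Prop34_i` … `Prop34_viii` (and the per-tower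
predicates `Tower.PropI` … `Tower.PropVIII`) quantify over a BARE base `(D, π : D ⥤ D0)`; they do NOT
bind the standing hypotheses of Example 3.3 under which the paper forms `C`, `A`, `N`, `R` — "if `D` is
any connected, totally epimorphic category, and `D → D0` is a functor" (p. 28, ll. 20–21 of the
author's kurims text) — so, read literally over an arbitrary `D`, each named statement is formally
STRONGER than print. Binder-exact forms, where a consumer or a refutation row needs them, are the
guarded twins of shape `Prop34_<x>H : IsGraphConnected D → IsTotallyEpimorphic D → Prop34_<x> π`
(the cell's words for the two hypotheses, `Categories.lean`; `isGraphConnected_iff_isConnected`; the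
same binders as `ArchFrd.Ex33ii_isFrobenioid`) in a sibling file — none is retyped here. The
refutations-as-typed recorded against items (iii) and (viii) (`ArchFrd.not_prop34_iii_id`,
`ArchFrd.not_prop34_viii_id`, base `π = 𝟭 D0`) use a base that print itself asserts satisfies these
hypotheses — "`D0` is a connected, totally epimorphic category, which is of FSM-, hence also of
FSMFF-type" (p. 23, ll. 13–14; in the tree `ArchFrd.D0.isGraphConnected`, `ArchFrd.D0.isTotallyEpimorphic`)
— and the repaired readings are the sibling statements `Prop34_iiiR`, `Prop34_viR`
(`ArchimedeanFSMRegime.lean`). Nothing in this file asserts any item of Prop. 3.4; typed ≠ discharged.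
-/

namespace Literature.AlgebraicGeometry.Frobenioids

open CategoryTheory Opposite
open scoped Pointwise NNReal

noncomputable section

namespace ArchFrd

universe v u

variable {D : Type u} [Category.{v} D] (π : D ⥤ D0)

/-! ### The projections `A → A₀`, `N → N₀` (`R → R₀` is `R.toR0`) -/

/-- The projection `A → A₀` (an isometry of `C = C₀ ×_{D₀} D` has isometric `C₀`-component; the
pull-back maps of `Φ₀` are identities). [cite: MochizukiFrdII2008, Prop 3.4 p.29] -/
def A.toA0 : A π ⥤ A0 where
  obj X := ⟨X.obj.fst⟩
  map f := ⟨f.1.fst, f.2⟩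

/-- The projection `N → N₀`. [cite: MochizukiFrdII2008, Prop 3.4 p.29] -/
def N.toN0 : N π ⥤ N0 where
  obj X := ⟨⟨X.obj.obj.fst⟩⟩
  map f := ⟨⟨f.1.1.fst, f.1.2⟩, f.2⟩

/-! ### The tower `F → D`, `F → F₀ → D₀` of Proposition 3.4 -/

/-- The data Proposition 3.4 speaks about, for `F ∈ {A, N, R}` (FrdII p. 29): the category `F` with its
projections `F → D` and `F → F₀ → D₀`, the pre-Frobenioid structures through which Frobenioid-theoretic
words about `F`, `F₀` are read, and the underlying angular region of an object (for slit morphisms).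
[cite: MochizukiFrdII2008, Prop 3.4 p.29] -/
structure Tower (π : D ⥤ D0) where
  /-- the category `F` -/
  F : Type u
  [instF : Category.{v} F]
  /-- the category `F₀` -/
  F0 : Type
  [instF0 : Category.{0} F0]
  /-- the projection `F → D` -/
  toD : F ⥤ D
  /-- the projection `F → F₀` -/
  toF0 : F ⥤ F0
  /-- the projection `F₀ → D₀` -/
  base0 : F0 ⥤ D0
  /-- divisor monoid for the Frobenioid-theoretic words about `F` -/
  monoid : Dᵒᵖ ⥤ CommMonCat.{0}
  /-- the pre-Frobenioid structure through which words about `F` are read -/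
  str : F ⥤ ElemFrobenioid monoid
  /-- divisor monoid for the words about `F₀` -/
  monoid0 : D0ᵒᵖ ⥤ CommMonCat.{0}
  /-- the pre-Frobenioid structure through which words about `F₀` are read -/
  str0 : F0 ⥤ ElemFrobenioid monoid0
  /-- the underlying angular region of an object -/
  region : F → AngularRegion ℂ

namespace Tower

variable {π}

/-- `F` is a category. [cite: MochizukiFrdII2008, Prop 3.4 p.29] -/
instance instCategoryF (T : Tower π) : Category T.F := T.instF

/-- `F₀` is a category. [cite: MochizukiFrdII2008, Prop 3.4 p.29] -/
instance instCategoryF0 (T : Tower π) : Category T.F0 := T.instF0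

variable (T : Tower π)

/-- The projection `F → D₀` (through `D`). [cite: MochizukiFrdII2008, Prop 3.4 p.29] -/
abbrev toD0 : T.F ⥤ D0 := T.toD ⋙ π

/-- A *slit morphism* of `F` (Ex. 3.3 (v)): an isotropic hull of an object with slit angular region.
[cite: MochizukiFrdII2008, Ex 3.3 (v) p.29] -/
def IsSlit {X Y : T.F} (h : X ⟶ Y) : Prop :=
  PreFrobenioid.IsIsotropicHull T.str h ∧ IsSlitRegion (T.region X)

end Tower

/-- The tower of the angular Frobenioid: `F = A`, `F₀ = A₀` (words about `A`, `A₀` in their own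
Frobenioid structures over the zero monoid). [cite: MochizukiFrdII2008, Prop 3.4 p.29] -/
def towerA : Tower π where
  F := A π
  F0 := A0
  toD := A.toBase π
  toF0 := A.toA0 π
  base0 := A0.toD0
  monoid := (zeroMonoid D : Dᵒᵖ ⥤ CommMonCat.{0})
  str := A.toElem π
  monoid0 := (zeroMonoid D0 : D0ᵒᵖ ⥤ CommMonCat.{0})
  str0 := A0.toElem
  region X := X.obj.fst.region

/-- The tower of the non-rigidified angloid: `F = N`, `F₀ = N₀` (words read through the images in
`C`, `C₀`). [cite: MochizukiFrdII2008, Prop 3.4 p.29] -/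
def towerN : Tower π where
  F := N π
  F0 := N0
  toD := N.toBase π
  toF0 := N.toN0 π
  base0 := N0.toD0
  monoid := Φ π
  str := N.toC π ⋙ C.toElem π
  monoid0 := Φ₀
  str0 := N0.toC0 ⋙ C0.toElem
  region X := X.obj.obj.fst.region

/-- The tower of the rigidified angloid: `F = R`, `F₀ = R₀` (words read through the images in `C`,
`C₀`). [cite: MochizukiFrdII2008, Prop 3.4 p.29] -/
def towerR : Tower π where
  F := R π
  F0 := R0
  toD := R.toBase π
  toF0 := R.toR0 π
  base0 := R0.toD0
  monoid := Φ π
  str := R.toC π ⋙ C.toElem π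
  monoid0 := Φ₀
  str0 := R0.toC0 ⋙ C0.toElem
  region X := (R0.toC0.obj X.fst).region

/-! ### Proposition 3.4 (i)–(viii) as predicates of a tower -/

namespace Tower

variable {π} (T : Tower π)

/-- (i) for a tower: "Fiberwise-surjective morphisms of `F` project to fiberwise-surjective morphisms of
`D`." [cite: MochizukiFrdII2008, Prop 3.4 (i) p.29] -/
def PropI : Prop :=
  ∀ ⦃X Y : T.F⦄ (φ : X ⟶ Y), IsFiberwiseSurjective φ → IsFiberwiseSurjective (T.toD.map φ)

/-- Condition (a) of (ii): "`φ` projects to an isomorphism of `D₀`". [cite: MochizukiFrdII2008, Prop 3.4 (ii) p.30] -/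
def CondA {X Y : T.F} (φ : X ⟶ Y) : Prop := IsIso (T.toD0.map φ)

/-- Condition (b) of (ii): "`φ` admits a factorization `A → A′ → B` as a composite of a morphism of
Frobenius type `A → A′` and a linear morphism `A′ → B` such that any isotropic hull `A′ → A″` of `A′` is
either an isomorphism or a slit morphism". [cite: MochizukiFrdII2008, Prop 3.4 (ii) p.30] -/
def CondB {X Y : T.F} (φ : X ⟶ Y) : Prop :=
  ∃ (X' : T.F) (β : X ⟶ X') (α : X' ⟶ Y), β ≫ α = φ ∧ PreFrobenioid.IsFrobeniusType T.str β ∧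
    PreFrobenioid.IsLinear T.str α ∧
      ∀ (X'' : T.F) (h : X' ⟶ X''), PreFrobenioid.IsIsotropicHull T.str h → IsIso h ∨ T.IsSlit h

/-- (ii) for a tower: a monomorphism `φ` of `F` satisfying (a) or (b) "projects to a monomorphism
`φ_D` of `D`." [cite: MochizukiFrdII2008, Prop 3.4 (ii) p.30] -/
def PropII : Prop :=
  ∀ ⦃X Y : T.F⦄ (φ : X ⟶ Y), Mono φ → (T.CondA φ ∨ T.CondB φ) → Mono (T.toD.map φ)

/-- (iii) for a tower: "FSM-morphisms of `F` project to FSM-morphisms of `D`."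
[cite: MochizukiFrdII2008, Prop 3.4 (iii) p.30] -/
def PropIII : Prop := ∀ ⦃X Y : T.F⦄ (φ : X ⟶ Y), IsFSM φ → IsFSM (T.toD.map φ)

/-- (iv) for a tower: "Suppose that `D` is complexifiable. Then any FSM-morphism (respectively,
FSMI-morphism) of `F` that projects to an isomorphism of `D` projects to an FSM-morphism (respectively,
FSMI-morphism) of `F₀`." [cite: MochizukiFrdII2008, Prop 3.4 (iv) p.30] -/
def PropIV : Prop :=
  RC.IsComplexifiable (π ⋙ D0.toArchBase) →
    ∀ ⦃X Y : T.F⦄ (φ : X ⟶ Y), IsIso (T.toD.map φ) →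
      (IsFSM φ → IsFSM (T.toF0.map φ)) ∧ (IsFSMI φ → IsFSMI (T.toF0.map φ))

/-- (v) for a tower: "Any morphism of `F` that projects to an irreducible morphism (respectively,
isomorphism; irreducible morphism) of `D`, to an isomorphism (respectively, irreducible morphism;
irreducible morphism) of `F₀`, and to a(n) isomorphism (respectively, isomorphism; non-isomorphism) of
`D₀` is an irreducible morphism of `F`." [cite: MochizukiFrdII2008, Prop 3.4 (v) p.30] -/
def PropV : Prop :=
  ∀ ⦃X Y : T.F⦄ (φ : X ⟶ Y),
    (IsIrreducibleHom (T.toD.map φ) → IsIso (T.toF0.map φ) → IsIso (T.toD0.map φ) →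
      IsIrreducibleHom φ) ∧
    (IsIso (T.toD.map φ) → IsIrreducibleHom (T.toF0.map φ) → IsIso (T.toD0.map φ) →
      IsIrreducibleHom φ) ∧
    (IsIrreducibleHom (T.toD.map φ) → IsIrreducibleHom (T.toF0.map φ) → ¬ IsIso (T.toD0.map φ) →
      IsIrreducibleHom φ)

/-- (vi) for a tower: "If `φ` is a morphism of `F` such that `φ_D := Base(φ)` admits a factorization
`φ_D = α_D ∘ β_D` in `D`, then there exist morphisms `α`, `β` of `F` lifting `α_D`, `β_D`, respectively,
such that `φ = α ∘ β` in `F`" (lifting up to an identification of the middle object).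
[cite: MochizukiFrdII2008, Prop 3.4 (vi) p.30] -/
def PropVI : Prop :=
  ∀ ⦃X Y : T.F⦄ (φ : X ⟶ Y) (E : D) (βD : T.toD.obj X ⟶ E) (αD : E ⟶ T.toD.obj Y),
    βD ≫ αD = T.toD.map φ →
      ∃ (E' : T.F) (β : X ⟶ E') (α : E' ⟶ Y) (i : T.toD.obj E' ≅ E),
        β ≫ α = φ ∧ T.toD.map β ≫ i.hom = βD ∧ i.inv ≫ T.toD.map α = αD

/-- (vi), "In particular": "irreducible morphisms of `F` project to either isomorphisms or irreducible
morphisms of `D`". [cite: MochizukiFrdII2008, Prop 3.4 (vi) p.30] -/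
def PropVI_irreducible : Prop :=
  ∀ ⦃X Y : T.F⦄ (φ : X ⟶ Y), IsIrreducibleHom φ → IsIso (T.toD.map φ) ∨ IsIrreducibleHom (T.toD.map φ)

/-- (vi), "In particular": "FSMI-morphisms of `F` project to either isomorphisms or FSMI-morphisms of
`D`". [cite: MochizukiFrdII2008, Prop 3.4 (vi) p.30] -/
def PropVI_FSMI : Prop :=
  ∀ ⦃X Y : T.F⦄ (φ : X ⟶ Y), IsFSMI φ → IsIso (T.toD.map φ) ∨ IsFSMI (T.toD.map φ)

/-- (vii) for a tower: "Let `φ` be a morphism of `F` that projects to a pull-back morphism of `F₀` and to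
an FSM-morphism (respectively, FSMI-morphism) of `D`. Then `φ` is an FSM-morphism (respectively,
FSMI-morphism) of `F`." [cite: MochizukiFrdII2008, Prop 3.4 (vii) p.30] -/
def PropVII : Prop :=
  ∀ ⦃X Y : T.F⦄ (φ : X ⟶ Y), PreFrobenioid.IsPullbackMorphism T.str0 (T.toF0.map φ) →
    (IsFSM (T.toD.map φ) → IsFSM φ) ∧ (IsFSMI (T.toD.map φ) → IsFSMI φ)

/-- (viii) for a tower: "Suppose that `D` is complexifiable, RC-connected, and of FSMFF-type. Then `F` is
complexifiable, RC-connected [hence, in particular, connected], totally epimorphic, and of FSMFF-type."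
[cite: MochizukiFrdII2008, Prop 3.4 (viii) p.30] -/
def PropVIII : Prop :=
  RC.IsComplexifiable (π ⋙ D0.toArchBase) → RC.IsRCConnected (π ⋙ D0.toArchBase) →
    IsOfFSMFFType D →
      RC.IsComplexifiable (T.toD0 ⋙ D0.toArchBase) ∧ RC.IsRCConnected (T.toD0 ⋙ D0.toArchBase) ∧
        IsTotallyEpimorphic T.F ∧ IsOfFSMFFType T.F

end Tower

/-! ### Proposition 3.4 (i)–(viii): the printed items (`F ∈ {A, N, R}`) -/

/-- **Proposition 3.4 (i)** (for `F = A, N, R`): "Fiberwise-surjective morphisms of `F` project to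
fiberwise-surjective morphisms of `D`." [cite: MochizukiFrdII2008, Prop 3.4 (i) p.29] -/
def Prop34_i : Prop := (towerA π).PropI ∧ (towerN π).PropI ∧ (towerR π).PropI

/-- **Proposition 3.4 (ii)** (for `F = A, N, R`): monomorphisms satisfying (a) or (b) project to
monomorphisms of `D`. [cite: MochizukiFrdII2008, Prop 3.4 (ii) p.30] -/
def Prop34_ii : Prop := (towerA π).PropII ∧ (towerN π).PropII ∧ (towerR π).PropII

/-- **Proposition 3.4 (iii)** (for `F = A, N, R`): "FSM-morphisms of `F` project to FSM-morphisms of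
`D`." [cite: MochizukiFrdII2008, Prop 3.4 (iii) p.30] -/
def Prop34_iii : Prop := (towerA π).PropIII ∧ (towerN π).PropIII ∧ (towerR π).PropIII

/-- **Proposition 3.4 (iv)** (for `F = A, N, R`; `D` complexifiable). [cite: MochizukiFrdII2008, Prop 3.4 (iv) p.30] -/
def Prop34_iv : Prop := (towerA π).PropIV ∧ (towerN π).PropIV ∧ (towerR π).PropIV

/-- **Proposition 3.4 (v)** (for `F = A, N, R`). [cite: MochizukiFrdII2008, Prop 3.4 (v) p.30] -/
def Prop34_v : Prop := (towerA π).PropV ∧ (towerN π).PropV ∧ (towerR π).PropV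

/-- **Proposition 3.4 (vi)** (for `F = A, N, R`), with its two "in particular" clauses.
[cite: MochizukiFrdII2008, Prop 3.4 (vi) p.30] -/
def Prop34_vi : Prop :=
  ((towerA π).PropVI ∧ (towerA π).PropVI_irreducible ∧ (towerA π).PropVI_FSMI) ∧
  ((towerN π).PropVI ∧ (towerN π).PropVI_irreducible ∧ (towerN π).PropVI_FSMI) ∧
  ((towerR π).PropVI ∧ (towerR π).PropVI_irreducible ∧ (towerR π).PropVI_FSMI)

/-- **Proposition 3.4 (vii)** (for `F = A, N, R`). [cite: MochizukiFrdII2008, Prop 3.4 (vii) p.30] -/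
def Prop34_vii : Prop := (towerA π).PropVII ∧ (towerN π).PropVII ∧ (towerR π).PropVII

/-- **Proposition 3.4 (viii)** (for `F = A, N, R`; `D` complexifiable, RC-connected, of FSMFF-type).
[cite: MochizukiFrdII2008, Prop 3.4 (viii) p.30] -/
def Prop34_viii : Prop := (towerA π).PropVIII ∧ (towerN π).PropVIII ∧ (towerR π).PropVIII

/-! ### Remark 3.4.1, p. 33 -/

/-- **Remark 3.4.1**: "there exist monomorphisms of `G` [`= N`, `R`] that do not satisfy either of the
conditions of Proposition 3.4, (ii), and which fail to project to monomorphisms of `D`. Indeed, by using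
angular regions whose projections to `S¹` fail to intersect `{1, −1}`, one may construct examples of
linear monomorphisms `φ : A → B` of `G₀`, where `A` is complex, and `B` is real [so the projection of
`φ` to `D₀` is not a monomorphism]" — the existence statement for `G₀ = N₀` and `G₀ = R₀`.
DISCLOSURE (referee note J9-F2): the typed `∃` records "monomorphism, complex domain, real codomain,
not projecting to a monomorphism of `D₀`" but drops print's attribute "LINEAR" of the constructed
monomorphisms (an under-claim; the witnesses used in `Rmk341_holds` are in fact linear isometries —
`ArchFrd.C0.upperToReal` has `degFr = 1`). [cite: MochizukiFrdII2008, Rmk 3.4.1 p.33] -/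
def Rmk341 : Prop :=
  (∃ (X Y : N0) (φ : X ⟶ Y), Mono φ ∧ X.carrier.IsComplexObj ∧ Y.carrier.IsRealObj ∧
      ¬ Mono (N0.toD0.map φ)) ∧
  (∃ (X Y : R0) (φ : X ⟶ Y), Mono φ ∧ (R0.toC0.obj X).IsComplexObj ∧ (R0.toC0.obj Y).IsRealObj ∧
      ¬ Mono (R0.toD0.map φ))

/-- **Remark 3.4.1** — PROVED: the upper-half-circle object and the arrow `(Spec ℂ → Spec ℝ, 1, 1)` of
`ArchimedeanMonoCounterexample.lean` (`N0.exists_mono_not_projecting`, `R0.exists_mono_not_projecting`).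
[cite: MochizukiFrdII2008, Rmk 3.4.1 p.33] -/
theorem Rmk341_holds : Rmk341 :=
  ⟨N0.exists_mono_not_projecting, R0.exists_mono_not_projecting⟩

end ArchFrd

end

end Literature.AlgebraicGeometry.Frobenioids
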